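import Summits.QuantumFields.YangMills.Theorems.SwapVirialDeficitSectorLaplaceBulkFibredPlane
import HarnessLib

/-!
# THE RESCALED BULK FIBRED LAPLACE ESTIMATE OVER AN ARBITRARY MEASURABLE BASE SET, FLOORS AS HYPOTHESES
# (free-hands support of ⟨stmt-QuantumFields-24197⟩ `SwapVirialDeficit.SwapGluedStiffness` ∕ ⟨24194⟩; cell ym-idea-1, LEAD g98 memo5∕6 — regions may sub-partition a hub set
# by the base point `(x₀,y₀)`, e.g. the generic END fibres `{x₀² + y₀² ≥ τ²}` (LEAD 19:07Z∕19:13Z, w3 ✓`fibre_raySecond_ge_endBulk_diag`))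

✓`SectorLaplace.bulk_fibred_plane` (file ✓`…SectorLaplaceBulkFibredPlane`) is the rescaled √b law over the WHOLE base plane with the BULK floors
(✓`fibQ_gnoScale_ge`, ✓`farFloor_gnoScale`: hub `sin²2ψ ≥ ψ₀`, `sin²ψ ≥ ψ₀`) built in.  A region of LEAD's skeleton ➎ that cuts the base plane (an END slab
`{x₀² + y₀² ≥ τ²}` at hubs `sin²2ψ < δ₀`, a B-tube complement, a sub-partition by `(x₀,y₀)`) needs the same law over a measurable `S ⊆ ℝ²` with ITS OWN uniform
coercivity ∕ far floor on `S`.  This file states exactly that, once, with the two floors as HYPOTHESES: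
* §1 `hubS1_pos`∕`hubS2_pos` (hub with `re a ≠ 0`, `im a ≠ 0`), `gnoScaleChart_image_prod_univ` (the rescaled chart has the same cylinders), `gnoScaleChart_base`;
* §2 ★★★ `bulk_fibred_scaled_cylinder` — hub `re a ≠ 0`, `im a ≠ 0`, good signs, `S` measurable with a point, `0 < λ`,
  `hcoerS : ∀ p ∈ S, ∀ y, λ‖y‖² ≤ Q_{a,ε,p}(gnoScale p y)`, `hfarS : ∀ p ∈ S, ∀ y, R ≤ ‖y‖ → λR² ≤ F̂(gnoFibreEquiv (p, gnoScale p y))`, `A₃ := 1242000L⁴`,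
  `0 < R`, `A₃R ≤ λ∕(8(m+8))`, `2R·R ≤ 1`, `0 < b`:
  `|∫_{(η_x0,η_y0) ∈ S} e^{−bF̂}ρ − (2π∕b)^{m∕2}∫_{p∈S} 𝔪(a,ε,p)| ≤ (K₃(λ)∕√b + 16(m+8)∕(λR²b))·Main_S + e^{−bλR²}·∫ρ`
  (sockets ✓`gnoFibre_rescaled_sockets` — whose identities do not depend on the size of the hub stiffness —, chart ✓`volume_gnoDensity_restrict_scaledTube_eq_map`,
  generic ✓`laplaceMethod_quantitative_fibred_chart_cubic_offBound_on`, off-tube ✓`offTube_bound_of_cylinder`);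
* §3 ★ `bulk_fibred_scaled_cylinder_of_hubBulk` — the base-set twin of ✓`bulk_fibred_plane_core` (bulk hub, `λ = ψ₀∕(82944L¹⁰)`, any measurable `S ∋ p₀`).

HONEST LABEL: one more socket-level theorem of the (S)∕➎ road (no new analysis: the floors are inputs); regions' laws, the core bound, ⟨24197⟩ ∕ ⟨24194⟩ OPEN; own crux
⟨22884⟩ `LargeFieldMassRefinementTail` OPEN (blocked-on ⟨19935⟩); the Yang–Mills mass gap is NOT proved; no summit is proved by a line.  THEOREMS ONLY (0 `def`,
0 `sorry`, no instance), standard axioms.  Width seat ym-line-sfw-p2-w2 g59 (cell ym-idea-1, free hands), `--supports stmt-QuantumFields-24197`.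
References: [cite: Luscher1983, §2]; [cite: HasenpflugRudolfSprungk2024, App. 4.1 Thm 16]; [cite: Breitung1994, Lemma 26 (2.102) p. 30]; [folklore].
-/

set_option autoImplicit false
set_option synthInstance.maxSize 1024

noncomputable section

open MeasureTheory Quaternion Set Metric Module
open scoped Quaternion BigOperators ENNReal InnerProductSpace
open Literature.MathematicalPhysics.QuantumLattice
open Literature.MathematicalPhysics.QuantumFieldTheory hiding SU2

namespace Summit.QuantumFields.YangMills.Theorems.SwapVirialDeficit.BlowUpRing

open Summit.QuantumFields.YangMills.Theorems.FemtoTransferGap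
open Summit.QuantumFields.YangMills.Theorems.FemtoTransferGap.TT
open Summit.QuantumFields.YangMills.Theorems.VirialFluxGap.RingDeficit
open Summit.QuantumFields.YangMills.Theorems.SwapVirialDeficit.SwapRing
open Summit.QuantumFields.YangMills.Theorems.SwapVirialDeficit.SectorLaplace (fibQ z₀ mbDensity alpha hubS1 hubS2)
open Summit.QuantumFields.YangMills.Theorems.QuantitativeLaplace (laplaceMethod_quantitative_fibred_chart_cubic_offBound_on offTube_bound_of_cylinder)

variable {L : ℕ} [NeZero L]

/-! ## §1 Letters -/

omit [NeZero L] in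
/-- A hub with `re a ≠ 0`, `im a ≠ 0` has positive stiffness `sin²2ψ > 0`. [folklore] -/
theorem hubS1_pos {a : ℍ} (hre : a.re ≠ 0) (him : a.im ≠ 0) : 0 < hubS1 a := by
  have ha : a ≠ 0 := fun h => hre (by rw [h]; rfl)
  have hn : 0 < ‖a‖⁻¹ := inv_pos.2 (norm_pos_iff.2 ha)
  have hi : 0 < ‖a.im‖ := norm_pos_iff.2 him
  unfold hubS1
  refine sq_pos_iff.2 (mul_ne_zero (mul_ne_zero two_ne_zero (mul_ne_zero hn.ne' hre)) (mul_ne_zero hn.ne' hi.ne'))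

omit [NeZero L] in
/-- … and `sin²ψ > 0`. [folklore] -/
theorem hubS2_pos {a : ℍ} (hre : a.re ≠ 0) (him : a.im ≠ 0) : 0 < hubS2 a := by
  have ha : a ≠ 0 := fun h => hre (by rw [h]; rfl)
  have hn : 0 < ‖a‖⁻¹ := inv_pos.2 (norm_pos_iff.2 ha)
  have hi : 0 < ‖a.im‖ := norm_pos_iff.2 him
  unfold hubS2
  positivity

/-- The rescaled chart has the base coordinates of its base point. [folklore] -/
theorem gnoScaleChart_base (p : ℝ × ℝ) (y : GnoFibre L) :
    ((gnoFibreEquiv (p, gnoScale p y)).1.1 0, (gnoFibreEquiv (p, gnoScale p y)).1.2 0) = p := by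
  rw [gnoFibreEquiv_apply']
  rfl

/-- The rescaled chart has the same cylinders: `Ψ′(S × V_L) = gnoFibreEquiv(S × V_L) = {η : (η_x0, η_y0) ∈ S}`. [folklore] -/
theorem gnoScaleChart_image_prod_univ (S : Set (ℝ × ℝ)) :
    (fun q : (ℝ × ℝ) × GnoFibre L => gnoFibreEquiv (q.1, gnoScale q.1 q.2)) '' (S ×ˢ (univ : Set (GnoFibre L))) = {η : GnoCoord L | (η.1.1 0, η.1.2 0) ∈ S} := by
  ext η
  constructor
  · rintro ⟨⟨p, y⟩, ⟨hp, -⟩, rfl⟩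
    show ((gnoFibreEquiv (p, gnoScale p y)).1.1 0, (gnoFibreEquiv (p, gnoScale p y)).1.2 0) ∈ S
    rw [gnoScaleChart_base]; exact hp
  · intro hη
    obtain ⟨⟨p, y⟩, rfl⟩ := gnoScaleChart_surjective (L := L) η
    refine ⟨(p, y), ⟨?_, mem_univ _⟩, rfl⟩
    have h := hη
    simp only [mem_setOf_eq] at h
    rw [gnoScaleChart_base] at h
    exact h

/-- A point of the cylinder outside the rescaled tube is `Ψ′(p, y)` with `p ∈ S`, `‖y‖ > R`. [folklore] -/
theorem exists_of_mem_cylinder_not_mem_scaledTube {S : Set (ℝ × ℝ)} {R : ℝ} {η : GnoCoord L} (hC : η ∈ {η : GnoCoord L | (η.1.1 0, η.1.2 0) ∈ S})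
    (hT : η ∉ (fun q : (ℝ × ℝ) × GnoFibre L => gnoFibreEquiv (q.1, gnoScale q.1 q.2)) '' (S ×ˢ closedBall (0 : GnoFibre L) R)) :
    ∃ p : ℝ × ℝ, p ∈ S ∧ ∃ y : GnoFibre L, R < ‖y‖ ∧ η = gnoFibreEquiv (p, gnoScale p y) := by
  obtain ⟨⟨p, y⟩, rfl⟩ := gnoScaleChart_surjective (L := L) η
  have hp : p ∈ S := by
    have h := hC
    simp only [mem_setOf_eq] at h
    rw [gnoScaleChart_base] at h
    exact h
  refine ⟨p, hp, y, ?_, rfl⟩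
  by_contra hle
  exact hT ⟨(p, y), ⟨hp, mem_closedBall_zero_iff.2 (not_lt.1 hle)⟩, rfl⟩

/-! ## §2 The rescaled bulk estimate over a measurable base set, floors as hypotheses -/

/-- ★★★ **THE RESCALED BULK FIBRED LAPLACE ESTIMATE OVER A MEASURABLE BASE SET `S ⊆ ℝ²`, FLOORS AS HYPOTHESES.**  Hub `re a ≠ 0`, `im a ≠ 0`, good signs
(`ε_z = +`, followers `+`); `S` measurable, `p₀ ∈ S`; `0 < λ` with the UNIFORM COERCIVITY `λ‖y‖² ≤ Q_{a,ε,p}(gnoScale p y)` and the UNIFORM FAR FLOOR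
`R ≤ ‖y‖ ⟹ λR² ≤ F̂(gnoFibreEquiv (p, gnoScale p y))` for `p ∈ S`; `A₃ := 1242000L⁴`, `0 < R`, `A₃R ≤ λ∕(8(m+8))`, `2R·R ≤ 1`, `0 < b`.  Then
`|∫_{(η_x0,η_y0)∈S} e^{−bF̂}ρ − (2π∕b)^{m∕2}·∫_{p∈S} 𝔪(a,ε,p)| ≤ (K₃∕√b + 16(m+8)∕(λR²b))·(2π∕b)^{m∕2}∫_{p∈S}𝔪 + e^{−bλR²}·∫ρ`,
`K₃ = 16A₃(m+8)∕λ + 256A₃(m+8)²∕λ² + 2R + 16R(m+8)∕λ`. [cite: Luscher1983, §2] [cite: HasenpflugRudolfSprungk2024, App. 4.1 Thm 16] -/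
theorem bulk_fibred_scaled_cylinder {a : ℍ} (hre : a.re ≠ 0) (him : a.im ≠ 0) (ε : GnoSign L) (hz : ε.2.1 = true) (hε : ε.2.2 = fun _ => true)
    {S : Set (ℝ × ℝ)} (hS : MeasurableSet S) {p₀ : ℝ × ℝ} (hp₀ : p₀ ∈ S) {lam : ℝ} (hlam : 0 < lam)
    (hcoerS : ∀ p ∈ S, ∀ y : GnoFibre L, lam * ‖y‖ ^ 2 ≤ fibQ a ε p (gnoScale p y))
    {R b : ℝ} (hR : 0 < R)
    (hfarS : ∀ p ∈ S, ∀ y : GnoFibre L, R ≤ ‖y‖ → lam * R ^ 2 ≤ gnoDeficit (fun _ => false) (fun _ => 1) a ε (gnoFibreEquiv (p, gnoScale p y)))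
    (hsmall : 1242000 * (L : ℝ) ^ 4 * R ≤ lam / (8 * ((finrank ℝ (GnoFibre L) : ℝ) + 8))) (hDR : 2 * R * R ≤ 1) (hb : 0 < b) :
    |(∫ η : GnoCoord L, {η : GnoCoord L | (η.1.1 0, η.1.2 0) ∈ S}.indicator
          (fun η => Real.exp (-(b * gnoDeficit (fun _ => false) (fun _ => 1) a ε η)) * gnoDensity η) η) -
        (2 * Real.pi / b) ^ ((finrank ℝ (GnoFibre L) : ℝ) / 2) * ∫ p in S, mbDensity a ε p| ≤
      ((16 * (1242000 * (L : ℝ) ^ 4) * ((finrank ℝ (GnoFibre L) : ℝ) + 8) / lam + 256 * (1242000 * (L : ℝ) ^ 4) * ((finrank ℝ (GnoFibre L) : ℝ) + 8) ^ 2 / lam ^ 2 +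
            2 * R + 8 * (2 * R) * ((finrank ℝ (GnoFibre L) : ℝ) + 8) / lam) / Real.sqrt b +
          16 * ((finrank ℝ (GnoFibre L) : ℝ) + 8) / (lam * R ^ 2) / b) *
        ((2 * Real.pi / b) ^ ((finrank ℝ (GnoFibre L) : ℝ) / 2) * ∫ p in S, mbDensity a ε p) +
      Real.exp (-(b * (lam * R ^ 2))) * ∫ η : GnoCoord L, gnoDensity η := by
  -- the measure space
  set μρ : Measure (GnoCoord L) := (volume : Measure (GnoCoord L)).withDensity fun η => ENNReal.ofReal (gnoDensity η) with hμρ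
  haveI : IsFiniteMeasure μρ := isFiniteMeasure_volume_gnoDensity
  have ha : a ≠ 0 := fun h => hre (by rw [h]; rfl)
  -- the rescaled sockets at ANY positive hub stiffness (their identities do not depend on its size)
  set ψ₁ : ℝ := min (min (hubS1 a) (hubS2 a)) 1 with hψ₁
  have hψ₁0 : 0 < ψ₁ := lt_min (lt_min (hubS1_pos hre him) (hubS2_pos hre him)) one_pos
  have hψ₁1 : ψ₁ ≤ 1 := min_le_right _ _
  have hψS1 : ψ₁ ≤ (2 * (‖a‖⁻¹ * a.re) * (‖a‖⁻¹ * ‖a.im‖)) ^ 2 := (min_le_left _ _).trans (min_le_left _ _)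
  have hψS2 : ψ₁ ≤ (‖a‖⁻¹ * ‖a.im‖) ^ 2 := (min_le_left _ _).trans (min_le_right _ _)
  obtain ⟨A, ρ, e, hAs, hAm, hρm, hem, hray, -, hf, hρb, hw, heb, hmain⟩ := gnoFibre_rescaled_sockets (L := L) ha ε hz hε hψ₁0 hψ₁1 hψS1 hψS2
  -- coercivity on `S` with the HYPOTHESIS constant
  have hcoer : ∀ p ∈ S, ∀ y : GnoFibre L, lam * ‖y‖ ^ 2 ≤ ⟪A p y, y⟫_ℝ := fun p hp y => by rw [hray]; exact hcoerS p hp y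
  -- chart, tube, weights
  obtain ⟨hTm, hchart⟩ := volume_gnoDensity_restrict_scaledTube_eq_map (L := L) hS R
  obtain ⟨hw0pos, hw0m, hw0i⟩ := rescaledWeight_facts
  have hJm : Measurable fun q : (ℝ × ℝ) × GnoFibre L => (∏ i, |gnoFibreScale (L := L) q.1 i|) * gnoDensity (gnoFibreEquiv (q.1, gnoScale q.1 q.2)) :=
    (Finset.measurable_prod _ fun i _ => ((measurable_gnoFibreScale i).comp measurable_fst).abs).mul (measurable_gnoDensity.comp (measurable_gnoScaleChart (L := L)))
  have hJ0 : ∀ q ∈ S ×ˢ closedBall (0 : GnoFibre L) R, 0 ≤ (∏ i, |gnoFibreScale (L := L) q.1 i|) * gnoDensity (gnoFibreEquiv (q.1, gnoScale q.1 q.2)) :=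
    fun q _ => mul_nonneg (Finset.prod_nonneg fun i _ => abs_nonneg _) (gnoDensity_pos _).le
  -- the cylinder and its indicator
  set C : Set (GnoCoord L) := {η : GnoCoord L | (η.1.1 0, η.1.2 0) ∈ S} with hC
  set φ : GnoCoord L → ℝ := C.indicator (fun _ => (1 : ℝ)) with hφ
  have hCm : MeasurableSet C := by rw [hC, ← gnoFibreEquiv_image_prod_univ]; exact measurableSet_cylinder hS
  have hφm : Measurable φ := measurable_const.indicator hCm
  have hw' : ∀ p ∈ S, ∀ y : GnoFibre L, ‖y‖ ≤ R →
      (∏ i, |gnoFibreScale (L := L) p i|) * gnoDensity (gnoFibreEquiv (p, gnoScale p y)) * φ (gnoFibreEquiv (p, gnoScale p y)) =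
        (1 + p.1 ^ 2)⁻¹ * (1 + p.2 ^ 2)⁻¹ * (1 + e (p, y)) := by
    intro p hp y _
    have hmem : gnoFibreEquiv (p, gnoScale p y) ∈ C := by
      show ((gnoFibreEquiv (p, gnoScale p y)).1.1 0, (gnoFibreEquiv (p, gnoScale p y)).1.2 0) ∈ S
      rw [gnoScaleChart_base]; exact hp
    rw [hφ, indicator_of_mem hmem]
    exact hw p y
  -- the off-tube bound on the product
  have hoff : ∀ x, x ∉ (fun q : (ℝ × ℝ) × GnoFibre L => gnoFibreEquiv (q.1, gnoScale q.1 q.2)) '' (S ×ˢ closedBall (0 : GnoFibre L) R) →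
      ‖Real.exp (-(b * (gnoDeficit (fun _ => false) (fun _ => 1) a ε x - 0))) * φ x‖ ≤ 1 * Real.exp (-(b * (lam * R ^ 2))) := by
    refine offTube_bound_of_cylinder (C := C) hb.le (fun x hx => by rw [hφ, indicator_of_notMem hx]) zero_le_one
      (fun x hx => by rw [hφ, indicator_of_mem hx, abs_one]) fun x hx hxT => ?_
    obtain ⟨p, hp, y, hRy, rfl⟩ := exists_of_mem_cylinder_not_mem_scaledTube hx hxT
    rw [zero_add]
    exact hfarS p hp y hRy.le
  -- the generic √b law on the base set `S`
  obtain ⟨-, hbd⟩ := laplaceMethod_quantitative_fibred_chart_cubic_offBound_on (X := GnoCoord L) (μ := μρ) (M := ℝ × ℝ) (ν := volume) (V := GnoFibre L)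
    (Ψ := fun q : (ℝ × ℝ) × GnoFibre L => gnoFibreEquiv (q.1, gnoScale q.1 q.2))
    (J := fun q => (∏ i, |gnoFibreScale (L := L) q.1 i|) * gnoDensity (gnoFibreEquiv (q.1, gnoScale q.1 q.2)))
    (f := gnoDeficit (fun _ => false) (fun _ => 1) a ε) (φ := φ) (f₀ := 0)
    hS hp₀ (A := A) (fun p _ => hAs p) hlam hcoer hAm (R := R) (A₃ := 1242000 * (L : ℝ) ^ 4) (D := 2 * R) (β := b) (Eoff := 1 * Real.exp (-(b * (lam * R ^ 2))))
    hR (by positivity) (by positivity) hb hsmall hDR (measurable_gnoScaleChart (L := L)) hTm hJm hJ0 hchart (measurable_gnoDeficit _ _ a ε) hφm hρm hem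
    hw0m (fun p _ => (hw0pos p).le) hw0i.integrableOn
    (fun p _ y _ => hρb p y) (fun p _ y hy => heb R hR.le p y hy) (fun p _ y _ => hf p y) hw' (by positivity) (Filter.Eventually.of_forall hoff)
  -- read the generic conclusion in the cylinder letters
  rw [one_mul, measureReal_volume_gnoDensity_univ] at hbd
  have hmainI : ∫ p in S, (1 + p.1 ^ 2)⁻¹ * (1 + p.2 ^ 2)⁻¹ / Real.sqrt (LinearMap.det (A p)) = ∫ p in S, mbDensity a ε p :=
    setIntegral_congr_fun hS fun p _ => hmain p
  rw [hmainI, ← integral_cylinder_eq_integral_withDensity] at hbd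
  exact hbd

/-! ## §3 The bulk-hub instance over a base set -/

/-- ★ **The base-set twin of ✓`bulk_fibred_plane_core`**: bulk hub (`0 < ψ₀ ≤ 1`, `ψ₀ ≤ sin²2ψ`, `ψ₀ ≤ sin²ψ`), good signs, measurable `S ∋ p₀`; `λ := ψ₀∕(82944L¹⁰)`
(✓`fibQ_gnoScale_ge`, ✓`farFloor_gnoScale` restricted to `S`). [cite: Luscher1983, §2] [cite: HasenpflugRudolfSprungk2024, App. 4.1 Thm 16] -/
theorem bulk_fibred_scaled_cylinder_of_hubBulk {a : ℍ} (hre : a.re ≠ 0) (him : a.im ≠ 0) (ε : GnoSign L) (hz : ε.2.1 = true) (hε : ε.2.2 = fun _ => true)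
    {ψ₀ : ℝ} (hψ₀ : 0 < ψ₀) (hψ₁ : ψ₀ ≤ 1) (hS1 : ψ₀ ≤ (2 * (‖a‖⁻¹ * a.re) * (‖a‖⁻¹ * ‖a.im‖)) ^ 2) (hS2 : ψ₀ ≤ (‖a‖⁻¹ * ‖a.im‖) ^ 2)
    {S : Set (ℝ × ℝ)} (hS : MeasurableSet S) {p₀ : ℝ × ℝ} (hp₀ : p₀ ∈ S)
    {R b : ℝ} (hR : 0 < R) (hR1 : R ≤ 1)
    (hsmall : 1242000 * (L : ℝ) ^ 4 * R ≤ ψ₀ / (82944 * (L : ℝ) ^ 10) / (8 * ((finrank ℝ (GnoFibre L) : ℝ) + 8))) (hDR : 2 * R * R ≤ 1) (hb : 0 < b) :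
    |(∫ η : GnoCoord L, {η : GnoCoord L | (η.1.1 0, η.1.2 0) ∈ S}.indicator
          (fun η => Real.exp (-(b * gnoDeficit (fun _ => false) (fun _ => 1) a ε η)) * gnoDensity η) η) -
        (2 * Real.pi / b) ^ ((finrank ℝ (GnoFibre L) : ℝ) / 2) * ∫ p in S, mbDensity a ε p| ≤
      ((16 * (1242000 * (L : ℝ) ^ 4) * ((finrank ℝ (GnoFibre L) : ℝ) + 8) / (ψ₀ / (82944 * (L : ℝ) ^ 10)) +
              256 * (1242000 * (L : ℝ) ^ 4) * ((finrank ℝ (GnoFibre L) : ℝ) + 8) ^ 2 / (ψ₀ / (82944 * (L : ℝ) ^ 10)) ^ 2 +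
            2 * R + 8 * (2 * R) * ((finrank ℝ (GnoFibre L) : ℝ) + 8) / (ψ₀ / (82944 * (L : ℝ) ^ 10))) / Real.sqrt b +
          16 * ((finrank ℝ (GnoFibre L) : ℝ) + 8) / (ψ₀ / (82944 * (L : ℝ) ^ 10) * R ^ 2) / b) *
        ((2 * Real.pi / b) ^ ((finrank ℝ (GnoFibre L) : ℝ) / 2) * ∫ p in S, mbDensity a ε p) +
      Real.exp (-(b * (ψ₀ / (82944 * (L : ℝ) ^ 10) * R ^ 2))) * ∫ η : GnoCoord L, gnoDensity η := by
  have ha : a ≠ 0 := fun h => hre (by rw [h]; rfl)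
  have hL : (0 : ℝ) < (L : ℝ) := by exact_mod_cast NeZero.pos L
  have hlam : 0 < ψ₀ / (82944 * (L : ℝ) ^ 10) := by positivity
  exact bulk_fibred_scaled_cylinder hre him ε hz hε hS hp₀ hlam (fun p _ y => fibQ_gnoScale_ge ha ε hz hε hψ₀ hψ₁ hS1 hS2 p y) hR
    (fun p _ y hy => farFloor_gnoScale ha ε hε hψ₀ hψ₁ hS1 hS2 p y hR.le hR1 hy) hsmall hDR hb

end Summit.QuantumFields.YangMills.Theorems.SwapVirialDeficit.BlowUpRing

end
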